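import Literature.NumberTheory.GaloisCohomology.Howard2004.ResidualSelmerEigenParityProofs
import Literature.NumberTheory.GaloisCohomology.Howard2004.DVRSettingEngineChebCoreProofs
import HarnessLib

/-!
# Howard 2004, Lemma 1.6.4 on a `DVRSetting`: the ENGINE's Čebotarev binder `hchebI` (Case i), from Lemma 1.6.2,
# the residual identification `H¹_{F(n)}(K,T̄) ≅ H¹_{F(n)}(K,T^{(k)})[𝔪]` and Lemma 1.5.3 (proofs file)

Topic `NumberTheory/GaloisCohomology/Howard2004` (sequel to `DVRSettingEngineChebCoreProofs` (CHEB-CORE),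
`ResidualSelmerEigenpartsProofs` (RES-EIGEN), `ResidualLevelControlProofs` (RES-CTRL) and
`ResidualSelmerEigenParityProofs` (Lemma 1.5.3 between `Sel_{F̄(nℓ)}^±` and `Sel_{F̄(n)}^±` as length identities)).  THEOREMS ONLY: no definition, no named fact, no instance, no notation, no `sorry`.

B. Howard, *The Heegner point Kolyvagin system*, Compositio Math. 140 (2004) = arXiv:1202.6340, Lemma 1.6.4, proof,
Case i (p. 12 L1–14): «`c` has some nonzero multiple `d ∈ H¹_{F(n)}(K,T^{(k)})[𝔪] ≅ H¹_{F(n)}(K,T̄)` … `d⁺ ≠ 0`.  We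
may choose `ℓ ∈ 𝓛^{(2k-1)}` such that `loc_ℓ(d) ≠ 0`, and … both `d⁺` and some element of `H¹_{F(n)}(K,T̄)⁻` have
nontrivial localization at `ℓ`.  By Lemma 1.5.3, `ρ(nℓ)^± = ρ(n)^± − 1`».  This is the binder `hchebI` of the engine
`DVRSettingEngineRedProofs.mem_stub_of_stubLemmaInduction_levels_guarded` (and of `…EngineData.…_levels'`) at
`P k := S.enginePrimes k`, `ϖ := S.π`, with `H k n`, `loc` read on the underlying classes
(`d ∈ H¹_{F(n)}(K,T^{(k)})`, `loc_ℓ d = galoisCohomology.localization … d`; the engine's `↥(S.selmerModuleAt hy k n)` /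
`locR.domRestrict` are these up to coercion) and with the engine's `ℕ`-valued `ρ^±` as VARIABLES `ρp ρm` bound to
the lengths of the eigenparts `H¹_{F̄(m)}(K,T̄)^± = Sel_{F̄_k(m)} ⊓ ker(τ_* ∓ id)` over `R_k` by the hypotheses
`hρp`/`hρm` (their definition as `toNat` of these lengths, and finiteness, belong to the instantiation).

INPUTS TAKEN AS BINDERS (Lemma 1.5.3's Galois letters, at every `ℓ ∈ 𝓛^{(2k-1)} ∖ n`, both signs, in the shape of
`EigenSelmerParityProofs.length_inf_comap_add_one_eq_of_exists` with `S := Sel_{F̄_k^ℓ(n)}` (relaxed at `ℓ`: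
`modify 𝒯̄ {ℓ} ∅ n`), `E := ker(τ_* ∓ id)`, `Lf := F̄_k(ℓ)`, `Lt := 𝒯̄(ℓ)`): `hdis` (Prop. 1.1.9: `F̄_ℓ ∩ H¹_tr = 0`),
`hGD^±` (the (GD-line) count `length loc_ℓ(S ⊓ E) = 1`), `hor^±` (the dichotomy, `EigenSelmerDichotomyProofs`).

* §1 `exists_mem_enginePrimes_localization_ne_zero_single` (CHEB-CORE for ONE eigenclass),
  `exists_enginePrime_seeing` (the prime of Case i for two non-zero eigenclasses of `Sel_{F̄(n)}`),
  `exists_residual_of_scalarMapH1_pi_eq_zero` (`d = H¹(ι) d̄`, `d̄ ∈ Sel_{F̄(n)}`, `d̄ ≠ 0`).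
* §2 `exists_eigenpair_of_mem_residualSelmer`, **`exists_enginePrime_caseI`** — the binder `hchebI` (Lemma 1.5.3 (a) via
  `ResidualSelmerEigenParityProofs.length_eigen_insert_add_one_eq`).

Cell `pub/bsd-print-x9`, G87 = Howard Thm. 1.6.1 (print leaf `stub_h161` of stmt-BirchSwinnertonDyer-22642); seat
`bsd-line-x10b-p1-w6` g9, brick (ENGINE-hcheb) part 2b.  `thm161_dvrKolyvaginBound` is NOT proved; BSD is not proved
by any of this.

References: [Howard2004HeegnerKolyvagin] Lemma 1.5.3, Lemma 1.6.2, Lemma 1.6.4; [SerreGaloisCohomology1997] I §2.2.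
-/

set_option autoImplicit false

noncomputable section

open Function NumberField IsDedekindDomain Field
open scoped NumberField ContRepresentation Classical

namespace Literature.NumberTheory.GaloisCohomology.Howard2004

open Literature.NumberTheory.GaloisRepresentations
open Literature.NumberTheory.GaloisRepresentations.DiscreteGaloisModule
open Literature.NumberTheory.EllipticCurves

namespace DVRSetting

variable {p : ℕ} [Fact p.Prime] {K : Type} [Field K] [NumberField K]
  {R : Type} [CommRing R] [IsDomain R] [IsDiscreteValuationRing R] [Algebra ℤ_[p] R]
  {N : ℕ → Type} [∀ k, AddCommGroup (N k)] [∀ k, TopologicalSpace (N k)]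
  [∀ k, DiscreteTopology (N k)] [∀ k, Module R (N k)]
  {Rk : ℕ → Type} [∀ k, CommRing (Rk k)] [∀ k, IsLocalRing (Rk k)] [∀ k, TopologicalSpace (Rk k)]
  [∀ k, DiscreteTopology (Rk k)] [∀ k, Algebra ℤ_[p] (Rk k)] [∀ k, Algebra R (Rk k)]
  [∀ k, Module (Rk k) (N k)] [∀ k, IsScalarTower R (Rk k) (N k)]
  {Nbar : Type} [AddCommGroup Nbar] [TopologicalSpace Nbar] [DiscreteTopology Nbar]
  [∀ k, Module (Rk k) Nbar]
  {Nq : ℕ → Finset (HeightOneSpectrum (𝓞 K)) → Type} [∀ k n, AddCommGroup (Nq k n)]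
  [∀ k n, TopologicalSpace (Nq k n)] [∀ k n, DiscreteTopology (Nq k n)]
  [∀ k n, Module (Rk k) (Nq k n)] [∀ k n, Module R (Nq k n)]
  [∀ k n, IsScalarTower R (Rk k) (Nq k n)]

/-! ## §1 The prime, and the residual class -/

/-- **CHEB-CORE for a single eigenclass**: for a `τ`-eigencocycle `φ` of sign `ε = ±1` with non-zero class there is
`v ∈ S.enginePrimes k`, `v ∉ n`, `v ∉ Σ`, with `loc_v[φ] ≠ 0` and `Γ_{K_v}` trivial on `T^{(k)}` (Lemma 1.6.2, one
class: `exists_mem_primes_localization_ne_zero_single`). [cite: Howard2004HeegnerKolyvagin, Lemma 1.6.2 and Lemma 1.6.4 Case ii (arXiv p. 11 L30–58, p. 12 L15–27)] -/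
theorem exists_mem_enginePrimes_localization_ne_zero_single [Finite Nbar] [∀ k, Finite (N k)]
    (S : DVRSetting p K R N Rk Nbar Nq) (hy : S.SatisfiesH) (hC : Automorphic.chebotarev_artinRep)
    (hp0 : ((p : ℕ) : R) ≠ 0) (hL : S.LargePrimes) (k : ℕ) (n : Finset (HeightOneSpectrum (𝓞 K)))
    (φ : contOneCocycles S.ρbar.toTopRep) {ε : Rk k} (hsign : ε = 1 ∨ ε = -1)
    (hφ : ∀ g, φ.1 (S.cd.conj g) = ε • (S.A k).θ (φ.1 g)) (hc : oneCocycleClass S.ρbar.toTopRep φ ≠ 0) :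
    ∃ v : HeightOneSpectrum (𝓞 K), v ∈ S.enginePrimes k ∧ v ∉ n ∧ (Sum.inr v : Place K) ∉ S.Sigma ∧
      galoisCohomology.localization S.ρbar (Sum.inr v) 1 (oneCocycleClass S.ρbar.toTopRep φ) ≠ 0 ∧
      ∀ (σ : absoluteGaloisGroup (v.adicCompletion K)) (y : N k), GaloisRep.toLocal v (S.T.ρ k) σ y = y := by
  classical
  obtain ⟨s₀, hs₀⟩ := hL
  set s : ℕ := max s₀ (2 * S.e k - 1)
  have hLs : S.T.kolyvaginPrimes p s ⊆ S.L := hs₀ s (le_max_left _ _)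
  obtain ⟨j, hj⟩ := S.exists_maximalIdeal_pow_e_le_span_pow hy hp0 s
  -- the eigencocycle condition at level `j`: `ε` at level `j` is the image of `±1`
  obtain ⟨ε', hε', hφ'⟩ : ∃ ε' : Rk j, (ε' = 1 ∨ ε' = -1) ∧ ∀ g, φ.1 (S.cd.conj g) = ε' • (S.A j).θ (φ.1 g) := by
    rcases hsign with rfl | rfl
    · exact ⟨1, Or.inl rfl, fun g => by rw [hφ g, one_smul, one_smul, S.theta_eq_theta hy k j]⟩
    · exact ⟨-1, Or.inr rfl, fun g => by rw [hφ g, neg_one_smul, neg_one_smul, S.theta_eq_theta hy k j]⟩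
  obtain ⟨v, hvn, hvSig, hvL, hvs, -, -, -, -, -, -, hne⟩ :=
    S.exists_mem_primes_localization_ne_zero_single hy hC hLs hj φ hε' hφ' hc
      (S₀ := (↑n : Set (HeightOneSpectrum (𝓞 K)))) n.finite_toSet
  have hvP : v ∈ S.enginePrimes k :=
    ⟨hvL, S.T.kolyvaginPrimes_antitone p (le_max_right s₀ (2 * S.e k - 1)) hvs⟩
  refine ⟨v, hvP, fun h => hvn (Finset.mem_coe.2 h), hvSig, hne, fun σ y => ?_⟩
  have h1 : 0 < S.e k := hy.e_zero.trans_le (hy.e_strictMono.monotone (Nat.zero_le k))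
  exact S.toLocal_apply_eq_self_of_subset_enginePrimes hy (k := k) (j := k) (by omega) (n := {v})
    (fun w hw => by rw [Finset.coe_singleton, Set.mem_singleton_iff] at hw; rw [hw]; exact hvP)
    (Finset.mem_singleton_self v) σ y

/-- **The prime of Case i**: for a `τ`-fixed class `c⁺ ≠ 0` and a `τ`-anti-fixed class `c⁻ ≠ 0` of `H¹(K, T̄)` there
is `v ∈ S.enginePrimes k`, `v ∉ n`, with `loc_v c⁺ ≠ 0`, `loc_v c⁻ ≠ 0`, `loc_v (c⁺ + c⁻) ≠ 0` and `Γ_{K_v}` trivial on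
`T^{(k)}` (eigencocycle representatives, `p` odd, + CHEB-CORE). [cite: Howard2004HeegnerKolyvagin, Lemma 1.6.2 and Lemma 1.6.4 Case i (arXiv p. 11 L30–58, p. 12 L1–9)] -/
theorem exists_enginePrime_seeing [Finite Nbar] [∀ k, Finite (N k)]
    (S : DVRSetting p K R N Rk Nbar Nq) (hy : S.SatisfiesH) (hC : Automorphic.chebotarev_artinRep)
    (hp0 : ((p : ℕ) : R) ≠ 0) (hL : S.LargePrimes) (k : ℕ) (n : Finset (HeightOneSpectrum (𝓞 K)))
    {cp cm : galoisCohomology S.ρbar 1}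
    (hτp : semilinearH S.cd.isLift (S.A k).θ.toAddMonoidHom (S.A k).isSemilinear 1 cp = cp)
    (hτm : semilinearH S.cd.isLift (S.A k).θ.toAddMonoidHom (S.A k).isSemilinear 1 cm = -cm)
    (hcp : cp ≠ 0) (hcm : cm ≠ 0) :
    ∃ v : HeightOneSpectrum (𝓞 K), v ∈ S.enginePrimes k ∧ v ∉ n ∧ (Sum.inr v : Place K) ∉ S.Sigma ∧
      galoisCohomology.localization S.ρbar (Sum.inr v) 1 cp ≠ 0 ∧
      galoisCohomology.localization S.ρbar (Sum.inr v) 1 cm ≠ 0 ∧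
      galoisCohomology.localization S.ρbar (Sum.inr v) 1 (cp + cm) ≠ 0 ∧
      ∀ (σ : absoluteGaloisGroup (v.adicCompletion K)) (y : N k), GaloisRep.toLocal v (S.T.ρ k) σ y = y := by
  obtain ⟨φp, hφpc, hφp⟩ := ResidualTau.exists_eigencocycle_of_semilinearH_eq (S.A k)
    (S.isScalarLinear_rhobar hy k) (S.isUnit_two hy k) cp hτp
  obtain ⟨φm, hφmc, hφm⟩ := ResidualTau.exists_eigencocycle_of_semilinearH_eq_neg (S.A k)
    (S.isScalarLinear_rhobar hy k) (S.isUnit_two hy k) cm hτm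
  obtain ⟨v, hvP, hvn, hvSig, hp', hm', hsum, htriv⟩ :=
    S.exists_mem_enginePrimes_localization_ne_zero hy hC hp0 hL k k n φp φm hφp hφm
      (by rw [hφpc]; exact hcp) (by rw [hφmc]; exact hcm)
  have e := oneCocycleClass_add S.ρbar.toTopRep φp φm
  have e' : (oneCocycleClass S.ρbar.toTopRep (φp + φm) : galoisCohomology S.ρbar 1) = cp + cm := by
    rw [← hφpc, ← hφmc]
    exact e
  refine ⟨v, hvP, hvn, hvSig, by rw [← hφpc]; exact hp', by rw [← hφmc]; exact hm', ?_, htriv⟩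
  rw [← e']
  exact hsum

/-- **`d = H¹(ι) d̄` with `d̄ ∈ H¹_{F̄(n)}(K, T̄)`, `d̄ ≠ 0`** for `d ∈ H¹_{F(n)}(K, T^{(k)})`, `d ≠ 0`, `π d = 0`, `n ⊆ 𝓛^{(2k-1)}`
(the residual inclusion `ι` of RES-CTRL; Lemma 1.3.3 with Lemma 1.5.1). [cite: Howard2004HeegnerKolyvagin, Lemma 1.6.4 proof (arXiv p. 12 L1–3: «some nonzero multiple `d ∈ H¹_{F(n)}(K,T^{(k)})[𝔪] ≅ H¹_{F(n)}(K,T̄)`»)] -/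
theorem exists_residual_of_scalarMapH1_pi_eq_zero (S : DVRSetting p K R N Rk Nbar Nq) (hy : S.SatisfiesH) (k : ℕ)
    {n : Finset (HeightOneSpectrum (𝓞 K))} (hn : ↑n ⊆ S.enginePrimes k) {d : galoisCohomology (S.T.ρ k) 1}
    (hd : d ∈ (((S.t k).atLevel S.jbar n).cond).selmerGroup) (hd0 : d ≠ 0)
    (hπ : galoisCohomology.scalarMapH1 (S.T.ρ k) (S.T.hlin k) S.π d = 0) :
    ∃ (ι : Nbar →ₗ[Rk k] N k) (hι : ∀ y : N k, ι (S.πbar k y) = S.π ^ (S.e k - 1) • y)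
      (dbar : galoisCohomology S.ρbar 1),
      dbar ∈ ((((hy.h1 k).1.propagateStructure (S.t k).cond).modify (transverseStructure p S.ρbar S.jbar)
        ∅ ∅ n)).selmerGroup ∧ dbar ≠ 0 ∧
      ContinuousRep.cohomologyMap S.ρbar (S.T.ρ k) ι.toAddMonoidHom continuous_of_discreteTopology
        (S.residualInclusion_equivariant hy k ι hι) 1 dbar = d := by
  obtain ⟨ι, hι⟩ := S.exists_residualInclusion hy k
  have h1 : 0 < S.e k := hy.e_zero.trans_le (hy.e_strictMono.monotone (Nat.zero_le k))
  obtain ⟨dbar, hdbar, rfl⟩ :=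
    (S.exists_mem_selmerGroup_atLevel_cohomologyMap_residualInclusion_eq_iff hy k ι hι
      (S.residualInclusion_equivariant hy k ι hι) n (S.htriv_of_subset_enginePrimes hy hn k (by omega)) d).2
      ⟨hd, hπ⟩
  refine ⟨ι, hι, dbar, hdbar, ?_, rfl⟩
  rintro rfl
  exact hd0 (map_zero _)

/-! ## §2 The binder `hchebI` (Case i of Lemma 1.6.4) -/

/-- **Two non-zero eigenclasses carrying `d̄`** (Case i bookkeeping): for `d̄ ∈ Sel_{F̄(n)}`, `d̄ ≠ 0`, with both
eigenparts `Sel_{F̄(n)}^±` of positive length, there are `c⁺ ∈ Sel_{F̄(n)}⁺`, `c⁻ ∈ Sel_{F̄(n)}⁻`, both non-zero, with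
`d̄ ∈ {c⁺, c⁻, c⁺ + c⁻}` (`d̄ = d̄⁺ + d̄⁻`; a vanishing component is replaced by any non-zero class of that sign —
«both `d⁺` and some element of `H¹_{F(n)}(K, T̄)⁻`»). [cite: Howard2004HeegnerKolyvagin, Lemma 1.6.4 Case i (arXiv p. 12 L3–9)] -/
theorem exists_eigenpair_of_mem_residualSelmer (S : DVRSetting p K R N Rk Nbar Nq) (hy : S.SatisfiesH) (k : ℕ)
    {n : Finset (HeightOneSpectrum (𝓞 K))} (hn : ↑n ⊆ S.enginePrimes k)
    (hposp : letI := galoisCohomology.moduleH1 S.ρbar (S.isScalarLinear_rhobar hy k);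
      0 < Module.length (Rk k) ↥(galoisCohomology.submoduleOfStable (S.isScalarLinear_rhobar hy k)
        ((((hy.h1 k).1.propagateStructure (S.t k).cond).modify (transverseStructure p S.ρbar S.jbar) ∅ ∅ n).selmerGroup ⊓
          ((semilinearH S.cd.isLift (S.A k).θ.toAddMonoidHom (S.A k).isSemilinear 1) - AddMonoidHom.id _).ker)
        (scalarMapH1_mem_inf S.ρbar (S.isScalarLinear_rhobar hy k) (S.scalarMapH1_mem_residualSelmer_modify hy k ∅ ∅ n)
          (S.scalarMapH1_mem_kerSub hy k))))
    (hposm : letI := galoisCohomology.moduleH1 S.ρbar (S.isScalarLinear_rhobar hy k);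
      0 < Module.length (Rk k) ↥(galoisCohomology.submoduleOfStable (S.isScalarLinear_rhobar hy k)
        ((((hy.h1 k).1.propagateStructure (S.t k).cond).modify (transverseStructure p S.ρbar S.jbar) ∅ ∅ n).selmerGroup ⊓
          ((semilinearH S.cd.isLift (S.A k).θ.toAddMonoidHom (S.A k).isSemilinear 1) + AddMonoidHom.id _).ker)
        (scalarMapH1_mem_inf S.ρbar (S.isScalarLinear_rhobar hy k) (S.scalarMapH1_mem_residualSelmer_modify hy k ∅ ∅ n)
          (S.scalarMapH1_mem_kerAdd hy k))))
    {dbar : galoisCohomology S.ρbar 1}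
    (hdbar : dbar ∈ (((hy.h1 k).1.propagateStructure (S.t k).cond).modify (transverseStructure p S.ρbar S.jbar) ∅ ∅ n).selmerGroup) (hdbar0 : dbar ≠ 0) :
    ∃ cp cm : galoisCohomology S.ρbar 1,
      cp ∈ (((hy.h1 k).1.propagateStructure (S.t k).cond).modify (transverseStructure p S.ρbar S.jbar) ∅ ∅ n).selmerGroup ⊓
        ((semilinearH S.cd.isLift (S.A k).θ.toAddMonoidHom (S.A k).isSemilinear 1) - AddMonoidHom.id _).ker ∧
      cm ∈ (((hy.h1 k).1.propagateStructure (S.t k).cond).modify (transverseStructure p S.ρbar S.jbar) ∅ ∅ n).selmerGroup ⊓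
        ((semilinearH S.cd.isLift (S.A k).θ.toAddMonoidHom (S.A k).isSemilinear 1) + AddMonoidHom.id _).ker ∧
      (semilinearH S.cd.isLift (S.A k).θ.toAddMonoidHom (S.A k).isSemilinear 1) cp = cp ∧
      (semilinearH S.cd.isLift (S.A k).θ.toAddMonoidHom (S.A k).isSemilinear 1) cm = -cm ∧
      cp ≠ 0 ∧ cm ≠ 0 ∧ (dbar = cp ∨ dbar = cm ∨ dbar = cp + cm) := by
  have hnσ : ∀ w ∈ n, S.cd.σ • w = w := fun w hw => S.sigma_smul_eq_self_of_mem_L hy (hn hw).1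
  have h0σ : ∀ w ∈ (∅ : Finset (HeightOneSpectrum (𝓞 K))), S.cd.σ • w = w :=
    fun w hw => absurd hw (Finset.notMem_empty w)
  obtain ⟨cp, cm, hcp, hcm, hτp, hτm, hsum, hne⟩ :=
    S.exists_eigen_decomposition_mem_ne_zero hy k h0σ hnσ hdbar hdbar0
  have hcpE : cp ∈ (((hy.h1 k).1.propagateStructure (S.t k).cond).modify (transverseStructure p S.ρbar S.jbar) ∅ ∅ n).selmerGroup ⊓
      ((semilinearH S.cd.isLift (S.A k).θ.toAddMonoidHom (S.A k).isSemilinear 1) - AddMonoidHom.id _).ker :=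
    ⟨hcp, (ResidualTau.mem_ker_sub_iff (S.A k) cp).2 hτp⟩
  have hcmE : cm ∈ (((hy.h1 k).1.propagateStructure (S.t k).cond).modify (transverseStructure p S.ρbar S.jbar) ∅ ∅ n).selmerGroup ⊓
      ((semilinearH S.cd.isLift (S.A k).θ.toAddMonoidHom (S.A k).isSemilinear 1) + AddMonoidHom.id _).ker :=
    ⟨hcm, (ResidualTau.mem_ker_add_iff (S.A k) cm).2 hτm⟩
  by_cases hp : cp = 0
  · have hm : cm ≠ 0 := hne.resolve_left (fun h => h hp)
    obtain ⟨c, hc, hc0⟩ := exists_ne_zero_of_length_pos S.ρbar (S.isScalarLinear_rhobar hy k)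
      (scalarMapH1_mem_inf S.ρbar (S.isScalarLinear_rhobar hy k) (S.scalarMapH1_mem_residualSelmer_modify hy k ∅ ∅ n)
          (S.scalarMapH1_mem_kerSub hy k)) hposp
    refine ⟨c, cm, hc, hcmE, (ResidualTau.mem_ker_sub_iff (S.A k) c).1 hc.2, hτm, hc0, hm, Or.inr (Or.inl ?_)⟩
    rw [hsum, hp, zero_add]
  by_cases hm : cm = 0
  · obtain ⟨c, hc, hc0⟩ := exists_ne_zero_of_length_pos S.ρbar (S.isScalarLinear_rhobar hy k)
      (scalarMapH1_mem_inf S.ρbar (S.isScalarLinear_rhobar hy k) (S.scalarMapH1_mem_residualSelmer_modify hy k ∅ ∅ n)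
          (S.scalarMapH1_mem_kerAdd hy k)) hposm
    refine ⟨cp, c, hcpE, hc, hτp, (ResidualTau.mem_ker_add_iff (S.A k) c).1 hc.2, hp, hc0, Or.inl ?_⟩
    rw [hsum, hm, add_zero]
  · exact ⟨cp, cm, hcpE, hcmE, hτp, hτm, hp, hm, Or.inr (Or.inr hsum)⟩

/-- **Howard's Lemma 1.6.4, Case i — the engine's binder `hchebI` DISCHARGED modulo the Lemma 1.5.3 letters.**  On a
`DVRSetting` with H.0–H.5, Čebotarev for Artin representations, `(p : R) ≠ 0` and `𝓛_s ⊆ 𝓛` for `s ≫ 0`; at level `k`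
with `ρ^±(m) = length_{R_k} (Sel_{F̄_k(m)} ⊓ ker(τ_* ∓ id))` for `m ⊆ 𝓛^{(2k-1)}` (`hρp`, `hρm`), and the letters
`hdis`, `hGD^±`, `hor^±` at every `ℓ ∈ 𝓛^{(2k-1)} ∖ n`: if `ρ(n)⁺ > 0`, `ρ(n)⁻ > 0`, then for every
`d ∈ H¹_{F(n)}(K, T^{(k)})`, `d ≠ 0`, `π d = 0`, there is `ℓ ∈ 𝓛^{(2k-1)}`, `ℓ ∉ n`, with `loc_ℓ d ≠ 0`,
`ρ(nℓ)⁺ + 1 = ρ(n)⁺` and `ρ(nℓ)⁻ + 1 = ρ(n)⁻`. [cite: Howard2004HeegnerKolyvagin, Lemma 1.6.4, Case i (arXiv:1202.6340 p. 12 L1–14), with Lemma 1.6.2 and Lemma 1.5.3 (a)] -/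
theorem exists_enginePrime_caseI [Finite Nbar] [∀ k, Finite (N k)]
    (S : DVRSetting p K R N Rk Nbar Nq) (hy : S.SatisfiesH) (hC : Automorphic.chebotarev_artinRep)
    (hp0 : ((p : ℕ) : R) ≠ 0) (hL : S.LargePrimes) (k : ℕ)
    (ρp ρm : ℕ → Finset (HeightOneSpectrum (𝓞 K)) → ℕ)
    (hρp : ∀ m : Finset (HeightOneSpectrum (𝓞 K)), ↑m ⊆ S.enginePrimes k →
      letI := galoisCohomology.moduleH1 S.ρbar (S.isScalarLinear_rhobar hy k);
      ((ρp k m : ℕ) : ℕ∞) = Module.length (Rk k) ↥(galoisCohomology.submoduleOfStable (S.isScalarLinear_rhobar hy k)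
        (((((hy.h1 k).1.propagateStructure (S.t k).cond).modify (transverseStructure p S.ρbar S.jbar)
            ∅ ∅ m)).selmerGroup ⊓
          (semilinearH S.cd.isLift (S.A k).θ.toAddMonoidHom (S.A k).isSemilinear 1 - AddMonoidHom.id _).ker)
        (scalarMapH1_mem_inf S.ρbar (S.isScalarLinear_rhobar hy k) (S.scalarMapH1_mem_residualSelmer_modify hy k ∅ ∅ m)
          (S.scalarMapH1_mem_kerSub hy k))))
    (hρm : ∀ m : Finset (HeightOneSpectrum (𝓞 K)), ↑m ⊆ S.enginePrimes k →
      letI := galoisCohomology.moduleH1 S.ρbar (S.isScalarLinear_rhobar hy k);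
      ((ρm k m : ℕ) : ℕ∞) = Module.length (Rk k) ↥(galoisCohomology.submoduleOfStable (S.isScalarLinear_rhobar hy k)
        (((((hy.h1 k).1.propagateStructure (S.t k).cond).modify (transverseStructure p S.ρbar S.jbar)
            ∅ ∅ m)).selmerGroup ⊓
          (semilinearH S.cd.isLift (S.A k).θ.toAddMonoidHom (S.A k).isSemilinear 1 + AddMonoidHom.id _).ker)
        (scalarMapH1_mem_inf S.ρbar (S.isScalarLinear_rhobar hy k) (S.scalarMapH1_mem_residualSelmer_modify hy k ∅ ∅ m)
          (S.scalarMapH1_mem_kerAdd hy k))))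
    {n : Finset (HeightOneSpectrum (𝓞 K))} (hn : ↑n ⊆ S.enginePrimes k)
    (hdis : ∀ v ∈ S.enginePrimes k, v ∉ n →
      Disjoint (((hy.h1 k).1.propagateStructure (S.t k).cond) (Sum.inr v))
        (transverseStructure p S.ρbar S.jbar (Sum.inr v)))
    (hGDp : ∀ v ∈ S.enginePrimes k, v ∉ n →
      letI := (galoisCohomology.moduleH1 (S.ρbar.toLocal (Sum.inr v))
        ((S.isScalarLinear_rhobar hy k).restrictField (Place.Completion (Sum.inr v))));
      Module.length (Rk k) ↥(galoisCohomology.submoduleOfStable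
        ((S.isScalarLinear_rhobar hy k).restrictField (Place.Completion (Sum.inr v)))
        ((((((hy.h1 k).1.propagateStructure (S.t k).cond).modify (transverseStructure p S.ρbar S.jbar)
            {v} ∅ n)).selmerGroup ⊓
          (semilinearH S.cd.isLift (S.A k).θ.toAddMonoidHom (S.A k).isSemilinear 1 - AddMonoidHom.id _).ker).map
          (galoisCohomology.localization S.ρbar (Sum.inr v) 1))
        (scalarMapH1_mem_map_localization S.ρbar (S.isScalarLinear_rhobar hy k) (Sum.inr v)
          (scalarMapH1_mem_inf S.ρbar (S.isScalarLinear_rhobar hy k) (S.scalarMapH1_mem_residualSelmer_modify hy k {v} ∅ n)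
          (S.scalarMapH1_mem_kerSub hy k)))) = 1)
    (horp : ∀ v ∈ S.enginePrimes k, v ∉ n →
      (((((hy.h1 k).1.propagateStructure (S.t k).cond).modify (transverseStructure p S.ρbar S.jbar)
            {v} ∅ n)).selmerGroup ⊓
          (semilinearH S.cd.isLift (S.A k).θ.toAddMonoidHom (S.A k).isSemilinear 1 - AddMonoidHom.id _).ker).map
          (galoisCohomology.localization S.ρbar (Sum.inr v) 1) ≤
          ((hy.h1 k).1.propagateStructure (S.t k).cond) (Sum.inr v) ∨
      (((((hy.h1 k).1.propagateStructure (S.t k).cond).modify (transverseStructure p S.ρbar S.jbar)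
            {v} ∅ n)).selmerGroup ⊓
          (semilinearH S.cd.isLift (S.A k).θ.toAddMonoidHom (S.A k).isSemilinear 1 - AddMonoidHom.id _).ker).map
          (galoisCohomology.localization S.ρbar (Sum.inr v) 1) ≤
          transverseStructure p S.ρbar S.jbar (Sum.inr v))
    (hGDm : ∀ v ∈ S.enginePrimes k, v ∉ n →
      letI := (galoisCohomology.moduleH1 (S.ρbar.toLocal (Sum.inr v))
        ((S.isScalarLinear_rhobar hy k).restrictField (Place.Completion (Sum.inr v))));
      Module.length (Rk k) ↥(galoisCohomology.submoduleOfStable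
        ((S.isScalarLinear_rhobar hy k).restrictField (Place.Completion (Sum.inr v)))
        ((((((hy.h1 k).1.propagateStructure (S.t k).cond).modify (transverseStructure p S.ρbar S.jbar)
            {v} ∅ n)).selmerGroup ⊓
          (semilinearH S.cd.isLift (S.A k).θ.toAddMonoidHom (S.A k).isSemilinear 1 + AddMonoidHom.id _).ker).map
          (galoisCohomology.localization S.ρbar (Sum.inr v) 1))
        (scalarMapH1_mem_map_localization S.ρbar (S.isScalarLinear_rhobar hy k) (Sum.inr v)
          (scalarMapH1_mem_inf S.ρbar (S.isScalarLinear_rhobar hy k) (S.scalarMapH1_mem_residualSelmer_modify hy k {v} ∅ n)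
          (S.scalarMapH1_mem_kerAdd hy k)))) = 1)
    (horm : ∀ v ∈ S.enginePrimes k, v ∉ n →
      (((((hy.h1 k).1.propagateStructure (S.t k).cond).modify (transverseStructure p S.ρbar S.jbar)
            {v} ∅ n)).selmerGroup ⊓
          (semilinearH S.cd.isLift (S.A k).θ.toAddMonoidHom (S.A k).isSemilinear 1 + AddMonoidHom.id _).ker).map
          (galoisCohomology.localization S.ρbar (Sum.inr v) 1) ≤
          ((hy.h1 k).1.propagateStructure (S.t k).cond) (Sum.inr v) ∨
      (((((hy.h1 k).1.propagateStructure (S.t k).cond).modify (transverseStructure p S.ρbar S.jbar)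
            {v} ∅ n)).selmerGroup ⊓
          (semilinearH S.cd.isLift (S.A k).θ.toAddMonoidHom (S.A k).isSemilinear 1 + AddMonoidHom.id _).ker).map
          (galoisCohomology.localization S.ρbar (Sum.inr v) 1) ≤
          transverseStructure p S.ρbar S.jbar (Sum.inr v))
    (hposp : 0 < ρp k n) (hposm : 0 < ρm k n)
    {d : galoisCohomology (S.T.ρ k) 1} (hd : d ∈ (((S.t k).atLevel S.jbar n).cond).selmerGroup) (hd0 : d ≠ 0)
    (hπ : galoisCohomology.scalarMapH1 (S.T.ρ k) (S.T.hlin k) S.π d = 0) :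
    ∃ ℓ ∈ S.enginePrimes k, ℓ ∉ n ∧ galoisCohomology.localization (S.T.ρ k) (Sum.inr ℓ) 1 d ≠ 0 ∧
      ρp k (insert ℓ n) + 1 = ρp k n ∧ ρm k (insert ℓ n) + 1 = ρm k n := by
  -- Step 1: the residual class `d̄ ∈ Sel_{F̄(n)}`, `d = H¹(ι) d̄`, `d̄ ≠ 0`
  obtain ⟨ι, hι, dbar, hdbar, hdbar0, rfl⟩ := S.exists_residual_of_scalarMapH1_pi_eq_zero hy k hn hd hd0 hπ
  -- Steps 2–3: two non-zero eigenclasses `cp' ∈ Sel⁺`, `cm' ∈ Sel⁻` with `d̄ ∈ {cp', cm', cp' + cm'}`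
  have hposp' := hposp
  have hposm' := hposm
  rw [← Nat.cast_pos (α := ℕ∞), hρp n hn] at hposp'
  rw [← Nat.cast_pos (α := ℕ∞), hρm n hn] at hposm'
  obtain ⟨cp', cm', hcp'E, hcm'E, hτp', hτm', hcp'0, hcm'0, hd3⟩ :=
    S.exists_eigenpair_of_mem_residualSelmer hy k hn hposp' hposm' hdbar hdbar0
  -- Step 4: the Čebotarev prime
  have hseen := S.exists_enginePrime_seeing hy hC hp0 hL k n (cp := cp') (cm := cm') hτp' hτm' hcp'0 hcm'0
  obtain ⟨v, hvP, hvn, _hvSig, hlp, hlm, hls, htriv⟩ := hseen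
  have hldbar : galoisCohomology.localization S.ρbar (Sum.inr v) 1 dbar ≠ 0 := by
    rcases hd3 with h | h | h <;> rw [h]
    exacts [hlp, hlm, hls]
  have hins : (↑(insert v n) : Set (HeightOneSpectrum (𝓞 K))) ⊆ S.enginePrimes k := by
    rw [Finset.coe_insert]
    exact Set.insert_subset hvP hn
  refine ⟨v, hvP, hvn,
    S.localization_cohomologyMap_residualInclusion_ne_zero hy k ι hι (S.residualInclusion_equivariant hy k ι hι)
      v htriv hldbar, ?_, ?_⟩
  · -- `ρ(nv)⁺ + 1 = ρ(n)⁺` (Lemma 1.5.3 (a), sign `+`, witness `cp'`)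
    have h := S.length_eigen_insert_add_one_eq hy k hvn _ (S.scalarMapH1_mem_kerSub hy k) (hdis v hvP hvn) (hGDp v hvP hvn) (horp v hvP hvn) ⟨cp', hcp'E, hlp⟩
    rw [← hρp _ hins, ← hρp n hn, ← Nat.cast_add_one, ENat.coe_inj] at h
    exact h
  · -- `ρ(nv)⁻ + 1 = ρ(n)⁻` (Lemma 1.5.3 (a), sign `−`, witness `cm'`)
    have h := S.length_eigen_insert_add_one_eq hy k hvn _ (S.scalarMapH1_mem_kerAdd hy k) (hdis v hvP hvn) (hGDm v hvP hvn) (horm v hvP hvn) ⟨cm', hcm'E, hlm⟩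
    rw [← hρm _ hins, ← hρm n hn, ← Nat.cast_add_one, ENat.coe_inj] at h
    exact h

end DVRSetting

end Literature.NumberTheory.GaloisCohomology.Howard2004

end
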